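import Literature.Analysis.ValidatedNumerics.PSDCertificate
import HarnessLib

/-!
# The affine-corner test: positivity of a matrix family on a parameter box from finitely many corner matrices

Topic `Literature/Analysis/ValidatedNumerics`. The box step of interval eigen-enclosure certificates for symmetric / Hermitian matrix
families `k ↦ f k` (Bloch symbols, dynamical matrices, parametrised Gram matrices): on a box `|k_j − k₀_j| ≤ h_j` (`j < d`) write
`f k = P₀ + Σ_j (k_j − k₀_j)·g_j + E(k)` with a uniform remainder bound `|vᵀE(k)v| ≤ R·vᵀv`; if the `2^d` CORNER matrices
`P₀ + Σ_j ε_j h_j·g_j − R·1` (`ε ∈ {±1}^d`) have nonnegative forms then so has `f k` for every `k` in the box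
(`form_nonneg_on_box`; PSD packaging `posSemidef_on_box`). The proof is the one-line convexity fact that an affine function of
`Δ ∈ Π[−h_j, h_j]` is bounded below by its value at the corner `ε_j = −sign(vᵀg_jv)` — no spectral theory, any dimension `d`, any
index type. The corner hypotheses are exactly what `PSDCertificate.lean` (`LDLᵀ` witnesses) or `IntervalGershgorin.lean` (witness-free)
discharge on literal data. No facts, no axioms.

## References
* R. E. Moore, R. B. Kearfott, M. J. Cloud, *Introduction to Interval Analysis*, SIAM 2009, §6.4 (mean-value / Taylor forms on boxes).
  [folklore]
* S. M. Rump, *Verification methods: rigorous results using floating-point arithmetic*, Acta Numerica 19 (2010) 287–449, §10.8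
  (verified eigenvalue inclusions of parametrised matrices). [folklore]
-/

open Matrix Finset

namespace Literature.Analysis.ValidatedNumerics.AffineCornerTest

variable {ι : Type*} [Fintype ι] {d : ℕ}

/-- The corner sign vector as reals: `±1`. [folklore] -/
def sgn (ε : Fin d → Bool) (j : Fin d) : ℝ := if ε j then 1 else -1

/-- An affine function of `Δ ∈ Π_j [−h_j, h_j]` is bounded below by its value at a suitable corner. [folklore] -/
theorem affine_ge_corner (a : ℝ) (b h Δ : Fin d → ℝ) (hΔ : ∀ j, |Δ j| ≤ h j) :
    ∃ ε : Fin d → Bool, a + ∑ j, sgn ε j * h j * b j ≤ a + ∑ j, Δ j * b j := by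
  refine ⟨fun j => decide (b j ≤ 0), ?_⟩
  suffices hs : ∑ j, sgn (fun j => decide (b j ≤ 0)) j * h j * b j ≤ ∑ j, Δ j * b j by linarith
  refine Finset.sum_le_sum fun j _ => ?_
  have hj := hΔ j
  rcases abs_le.1 hj with ⟨h1, h2⟩
  by_cases hb : b j ≤ 0
  · have hsg : sgn (fun j => decide (b j ≤ 0)) j = 1 := by simp [sgn, hb]
    rw [hsg]; nlinarith
  · have hsg : sgn (fun j => decide (b j ≤ 0)) j = -1 := by simp [sgn, hb]
    rw [hsg]; push Not at hb; nlinarith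

omit [Fintype ι] in
/-- Forms are linear in the matrix: `vᵀ(Σ_j c_j•g_j)v = Σ_j c_j·vᵀg_jv`. [folklore] -/
theorem form_sum_smul [Fintype ι] (v : ι → ℝ) (c : Fin d → ℝ) (g : Fin d → Matrix ι ι ℝ) :
    v ⬝ᵥ (∑ j, c j • g j) *ᵥ v = ∑ j, c j * (v ⬝ᵥ g j *ᵥ v) := by
  induction (Finset.univ : Finset (Fin d)) using Finset.induction_on with
  | empty => simp
  | insert a s ha ih =>
    rw [Finset.sum_insert ha, Finset.sum_insert ha, add_mulVec, dotProduct_add, ih, smul_mulVec, dotProduct_smul,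
      smul_eq_mul]

/-- **The affine-corner test (form version).** On the box `|k_j − k₀_j| ≤ h_j`: if the remainder of the affine model is uniformly
`≤ R·vᵀv` in absolute value and every corner matrix `P₀ + Σ_j ε_jh_j g_j` has form `≥ R·vᵀv`, then `vᵀ f(k) v ≥ 0`. [folklore] -/
theorem form_nonneg_on_box (f : (Fin d → ℝ) → Matrix ι ι ℝ) (k₀ h : Fin d → ℝ) (P₀ : Matrix ι ι ℝ)
    (g : Fin d → Matrix ι ι ℝ) (R : ℝ)
    (hrem : ∀ k, (∀ j, |k j - k₀ j| ≤ h j) → ∀ v : ι → ℝ,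
      |v ⬝ᵥ (f k - P₀ - ∑ j, (k j - k₀ j) • g j) *ᵥ v| ≤ R * (v ⬝ᵥ v))
    (hcorner : ∀ ε : Fin d → Bool, ∀ v : ι → ℝ, R * (v ⬝ᵥ v) ≤ v ⬝ᵥ (P₀ + ∑ j, (sgn ε j * h j) • g j) *ᵥ v)
    (k : Fin d → ℝ) (hk : ∀ j, |k j - k₀ j| ≤ h j) (v : ι → ℝ) : 0 ≤ v ⬝ᵥ f k *ᵥ v := by
  obtain ⟨ε, hε⟩ := affine_ge_corner (v ⬝ᵥ P₀ *ᵥ v) (fun j => v ⬝ᵥ g j *ᵥ v) h (fun j => k j - k₀ j) hk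
  have hc := hcorner ε v
  rw [add_mulVec, dotProduct_add, form_sum_smul] at hc
  have hr := hrem k hk v
  rw [sub_mulVec, sub_mulVec, dotProduct_sub, dotProduct_sub, form_sum_smul] at hr
  have hr' := (abs_le.1 hr).1
  simp only [mul_assoc] at hc hε
  linarith

/-- **The affine-corner test (PSD packaging).** With symmetric `f k` and corner hypotheses stated as
`(P₀ + Σ_j ε_jh_j g_j − R·1) ⪰ 0`, every `f k` on the box is positive semidefinite. [folklore] -/
theorem posSemidef_on_box [DecidableEq ι] (f : (Fin d → ℝ) → Matrix ι ι ℝ) (k₀ h : Fin d → ℝ) (P₀ : Matrix ι ι ℝ)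
    (g : Fin d → Matrix ι ι ℝ) (R : ℝ) (hsymm : ∀ k, (f k)ᵀ = f k)
    (hrem : ∀ k, (∀ j, |k j - k₀ j| ≤ h j) → ∀ v : ι → ℝ,
      |v ⬝ᵥ (f k - P₀ - ∑ j, (k j - k₀ j) • g j) *ᵥ v| ≤ R * (v ⬝ᵥ v))
    (hcorner : ∀ ε : Fin d → Bool, (P₀ + ∑ j, (sgn ε j * h j) • g j - R • (1 : Matrix ι ι ℝ)).PosSemidef)
    (k : Fin d → ℝ) (hk : ∀ j, |k j - k₀ j| ≤ h j) : (f k).PosSemidef :=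
  PosSemidef.of_dotProduct_mulVec_nonneg
    (by simpa [IsHermitian, conjTranspose_eq_transpose_of_trivial] using hsymm k) fun v => by
      simpa using form_nonneg_on_box f k₀ h P₀ g R hrem
        (fun ε v => PSDCert.le_dotProduct_mulVec_of_posSemidef_sub (hcorner ε) v) k hk v

end Literature.Analysis.ValidatedNumerics.AffineCornerTest
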